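import Mathlib
import HarnessLib
import Summits.ResolutionOfSingularities.ResolutionOfSingularities.Theorems.WildQuotientsWildQuotientResolutionS1aKillConormal
import Summits.ResolutionOfSingularities.ResolutionOfSingularities.Theorems.WildQuotientsWildQuotientResolutionS1aKillInitialJordan
import Summits.ResolutionOfSingularities.ResolutionOfSingularities.Theorems.WildQuotientsWildQuotientResolutionS1aAuxResidual

/-!
# S1a — INSTANCE I-2 (a1), ring level, MOVE 1 at the root: the (2,1)-centre on the plane `P = V(x₁, x₂)` is admissible with shift `δ = 1`, and its residual ideal contains `X₁ = x₁T²` and `X₂x₃ = (x₂T)·x₃`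

[OURS · L1 W4.5c · lead-1 g12; plan-1 A-KF v1 §4 (a1 by hand), X-CERT v0 MT-a1 move 1 «centre P = (x₁:2, x₂:1), δ=1: [x₁]₂ KILLED; N(x₂): β̃ = e₁, J̃′ = (x₁′, x₃)
⇒ T₁ = P̃′», RULING R-F15b; my FINDING F13 (B₊-coordinates: `aug σ_R = s·(X₁, X₂x₃)`)] — NOT statements of the manuscript; counted 0; AI-level work,
weaker than expert review. Crux stmt-ResolutionOfSingularities-17941 `CyclicQuotientFourfolds`, line `s1a-logminvertex` (`stub_reachLowerInF(X)`).

THE GERM a1 (two planes through a line; `p ≥ 5` for `σ^p = 1`): `σ` on `k[x₀, x₁, x₂, x₃]` (0-indexed: the memo's `x₁, x₂, x₃, x₄`) with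
`σ x₀ = x₀`, `σ x₁ = x₁ + x₀`, `σ x₂ = x₂ + x₀`, `σ x₃ = x₃ + x₁x₂`; fixed locus `V(x₀, x₁x₂) = P ∪ P′`. As for `J₄` (✓p645001) the datum is ABSTRACT:
a ring `A` with `e : A ≃ k[x]` and an automorphism `τ` of `A` with `τ = e⁻¹ ∘ σ ∘ e`; the centre is `f = (e⁻¹x₀, e⁻¹x₁)` with weights `(2, 1)`.
* `a1_admissible` — (a′)₁ with `β = 1`: `y ∈ 𝒥ₙ ⇒ τ y − y ∈ 𝒥ₙ₊₁` (rows: `x₁ ↦ x₀ ∈ 𝒥₂`, `x₂ ↦ x₀ ∈ 𝒥₂ ⊆ 𝒥₁`, `x₃ ↦ x₁x₂ ∈ 𝒥₁`); `a1_map_le` — `τ`-stability;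
* `a1_isRegular`, `a1_isRegularRing_quotient` — K1′ (transport of `isRegular_X_X` / `isRegularRing_quotient_X_X` along `e`);
* ★ `a1_augmentationIdeal_sigmaR_le` — (H1) on the cobordant algebra `R^w`: `aug σ_R ≤ (s)`, `s = T⁻¹` the exceptional parameter
  (`augmentationIdeal_sigmaR_le_span_of_admissible` with `β = 1`);
* ★ `a1_u'_zero_mem_residual`, `a1_u'_one_mul_mem_residual` — the RESIDUAL ideal `𝔞₁ = (aug σ_R : s)` contains `X₁ = u′₀ = x₀T²` (`(σ_R − 1)(x₁T) = x₀T = X₁·s`)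
  and `X₂·x₂ = u′₁·x₂` (`(σ_R − 1)(x₃) = x₁x₂ = s·(X₂x₂)`; 0-indexed `x₂` = the memo's `x₃`) — F13: `𝔞₁ ⊇ (X₁, X₂x₃)`, whose zero set on the norm chart is the
  strict transform `P̃′` and on the `[x₁]₂` chart is empty.
-/

set_option linter.dupNamespace false

noncomputable section

open Literature.AlgebraicGeometry.Resolution
open scoped LaurentPolynomial
open MvPolynomial
open Summit.ResolutionOfSingularities.ResolutionOfSingularities.Theorems.WildQuotientResolution.S1.CoarseChart
open Summit.ResolutionOfSingularities.ResolutionOfSingularities.Theorems.WildQuotientResolution.S1.BlowupCharts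

namespace Summit.ResolutionOfSingularities.ResolutionOfSingularities.Theorems.WildQuotientResolution.S1.KillCert.A1

variable {k : Type} [Field k] {A : Type} [CommRing A]
  (σ : MvPolynomial (Fin 4) k ≃+* MvPolynomial (Fin 4) k) (hC : ∀ a : k, σ (C a) = C a)
  (h0 : σ (X 0) = X 0) (h1 : σ (X 1) = X 1 + X 0) (h2 : σ (X 2) = X 2 + X 0) (h3 : σ (X 3) = X 3 + X 1 * X 2)
  (e : A ≃+* MvPolynomial (Fin 4) k) (τ : A ≃+* A) (hact : ∀ t : A, τ t = e.symm (σ (e t)))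

include hact in
/-- `τ` on the coordinates, through `e`. -/
theorem act_symm (y : MvPolynomial (Fin 4) k) : τ (e.symm y) = e.symm (σ y) := by
  rw [hact, e.apply_symm_apply]

/-! ## (a′)₁: the (2,1)-centre on `P` is admissible with `β = 1`, `δ = 1` -/

include hC h0 h1 h2 h3 hact in
/-- **(a′)₁ for a1's move 1**: `y ∈ 𝒥ₙ(f, (2,1)) ⇒ τ y − y ∈ (1)·𝒥ₙ₊₁`. [OURS · L1 W4.5c · a1 move 1] -/
theorem a1_admissible (n : ℕ) (y : A) (hy : y ∈ (weightedFiltration (e.symm ∘ ![X 0, X 1]) ![2, 1]).ideal n) :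
    τ y - y ∈ Ideal.span {(1 : A)} * (weightedFiltration (e.symm ∘ ![X 0, X 1]) ![2, 1]).ideal (n + 1) := by
  have hf0 : (e.symm ∘ ![X 0, X 1]) 0 = e.symm (X 0) := rfl
  have hf1 : (e.symm ∘ ![X 0, X 1]) 1 = e.symm (X 1) := rfl
  have hw1 : (![2, 1] : Fin 2 → ℕ) 1 = 1 := rfl
  have hX0 : (e.symm ∘ ![X 0, X 1]) 0 ∈ (weightedFiltration (e.symm ∘ ![X 0, X 1]) ![2, 1]).ideal 2 := mem_weightedFiltration_ideal (e.symm ∘ ![X 0, X 1]) ![2, 1] 0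
  have hX1 : (e.symm ∘ ![X 0, X 1]) 1 ∈ (weightedFiltration (e.symm ∘ ![X 0, X 1]) ![2, 1]).ideal 1 := mem_weightedFiltration_ideal (e.symm ∘ ![X 0, X 1]) ![2, 1] 1
  have h1J : ∀ {m : ℕ} {z : A}, z ∈ (weightedFiltration (e.symm ∘ ![X 0, X 1]) ![2, 1]).ideal m → z ∈ Ideal.span {(1 : A)} * (weightedFiltration (e.symm ∘ ![X 0, X 1]) ![2, 1]).ideal m :=
    fun hz => by rw [Ideal.span_singleton_one, Ideal.top_mul]; exact hz
  have hinc0 : τ (e.symm (X 0)) - e.symm (X 0) = 0 := by rw [act_symm σ e τ hact, h0, sub_self]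
  have hinc1 : τ (e.symm (X 1)) - e.symm (X 1) = (e.symm ∘ ![X 0, X 1]) 0 := by rw [act_symm σ e τ hact, h1, map_add, hf0]; ring
  have hinc2 : τ (e.symm (X 2)) - e.symm (X 2) = (e.symm ∘ ![X 0, X 1]) 0 := by rw [act_symm σ e τ hact, h2, map_add, hf0]; ring
  have hinc3 : τ (e.symm (X 3)) - e.symm (X 3) = (e.symm ∘ ![X 0, X 1]) 1 * e.symm (X 2) := by rw [act_symm σ e τ hact, h3, map_add, map_mul, hf1]; ring
  have hgen : Subring.closure (e.symm '' (Set.range (C : k → MvPolynomial (Fin 4) k) ∪ Set.range (X : Fin 4 → MvPolynomial (Fin 4) k))) = ⊤ := by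
    show Subring.closure ((e.symm : MvPolynomial (Fin 4) k →+* A) '' _) = ⊤
    rw [← RingHom.map_closure, closure_range_C_union_range_X k, ← RingHom.range_eq_map]
    exact RingHom.range_eq_top.mpr e.symm.surjective
  have m0 : τ (e.symm (X 0)) - e.symm (X 0) ∈ Ideal.span {(1 : A)} * (weightedFiltration (e.symm ∘ ![X 0, X 1]) ![2, 1]).ideal 1 := by
    rw [hinc0]; exact Ideal.zero_mem _
  have m1 : τ (e.symm (X 1)) - e.symm (X 1) ∈ Ideal.span {(1 : A)} * (weightedFiltration (e.symm ∘ ![X 0, X 1]) ![2, 1]).ideal 1 := by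
    rw [hinc1]; exact h1J ((weightedFiltration (e.symm ∘ ![X 0, X 1]) ![2, 1]).antitone (by norm_num : 1 ≤ 2) hX0)
  have m2 : τ (e.symm (X 2)) - e.symm (X 2) ∈ Ideal.span {(1 : A)} * (weightedFiltration (e.symm ∘ ![X 0, X 1]) ![2, 1]).ideal 1 := by
    rw [hinc2]; exact h1J ((weightedFiltration (e.symm ∘ ![X 0, X 1]) ![2, 1]).antitone (by norm_num : 1 ≤ 2) hX0)
  have m3 : τ (e.symm (X 3)) - e.symm (X 3) ∈ Ideal.span {(1 : A)} * (weightedFiltration (e.symm ∘ ![X 0, X 1]) ![2, 1]).ideal 1 := by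
    rw [hinc3]; exact h1J (Ideal.mul_mem_right _ _ hX1)
  refine admissible_of_generators (e.symm ∘ ![X 0, X 1]) ![2, 1] τ 1 _ hgen ?_ ?_ n y hy
  · rintro _ ⟨g, hg | hg, rfl⟩
    · obtain ⟨a, rfl⟩ := hg
      rw [act_symm σ e τ hact, hC, sub_self]; exact Ideal.zero_mem _
    · obtain ⟨i, rfl⟩ := hg
      fin_cases i
      exacts [m0, m1, m2, m3]
  · intro i
    fin_cases i
    · change τ ((e.symm ∘ ![X 0, X 1]) 0) - (e.symm ∘ ![X 0, X 1]) 0 ∈ _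
      rw [hf0, hinc0]; exact Ideal.zero_mem _
    · change τ ((e.symm ∘ ![X 0, X 1]) 1) - (e.symm ∘ ![X 0, X 1]) 1 ∈ Ideal.span {(1 : A)} * (weightedFiltration (e.symm ∘ ![X 0, X 1]) ![2, 1]).ideal ((![2, 1] : Fin 2 → ℕ) 1 + 1)
      rw [hf1, hinc1, hw1]; exact h1J hX0

include hC h0 h1 h2 h3 hact in
/-- **`τ`-stability of the filtration** of move 1. -/
theorem a1_map_le (n : ℕ) : ((weightedFiltration (e.symm ∘ ![X 0, X 1]) ![2, 1]).ideal n).map (τ : A →+* A) ≤ (weightedFiltration (e.symm ∘ ![X 0, X 1]) ![2, 1]).ideal n :=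
  map_le_of_admissible (e.symm ∘ ![X 0, X 1]) ![2, 1] τ 1 (a1_admissible σ hC h0 h1 h2 h3 e τ hact) n

/-! ## K1′ -/

/-- **K1′ (a)**: `(e⁻¹x₀, e⁻¹x₁)` is a regular sequence on `A`. -/
theorem a1_isRegular : RingTheory.Sequence.IsRegular A (List.ofFn (e.symm ∘ ![X 0, X 1])) :=
  IsRegular.of_ringEquiv_ofFn e.symm ![X 0, X 1] (isRegular_X_X k (0 : Fin 4) 1 (by decide))

/-- **K1′ (b)**: `A ⧸ (e⁻¹x₀, e⁻¹x₁)` is a regular ring. -/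
theorem a1_isRegularRing_quotient : IsRegularRing (A ⧸ Ideal.span (Set.range (e.symm ∘ ![X 0, X 1]))) :=
  isRegularRing_quotient_of_ringEquiv e.symm ![X 0, X 1] (isRegularRing_quotient_X_X k (0 : Fin 4) 1)

/-! ## (H1) and the residual ideal on the cobordant algebra -/

section Residual

variable {p : ℕ} (hp : 0 < p) (hσp : ∀ x : A, (⇑τ)^[p] x = x)

include hC h0 h1 h2 h3 hact in
/-- ★ **(H1) for a1's move 1**: on `R^w = A[s, x₀T², x₁T]`, `aug σ_R ≤ (s)` (exceptional divisor with multiplicity 1; `β = 1`, `δ = 1`). -/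
theorem a1_augmentationIdeal_sigmaR_le :
    augmentationIdeal (sigmaR τ (e.symm ∘ ![X 0, X 1]) ![2, 1] (a1_map_le σ hC h0 h1 h2 h3 e τ hact) hp hσp) ≤ Ideal.span {cobordantAlgebra.s (e.symm ∘ ![X 0, X 1]) ![2, 1]} := by
  have h := augmentationIdeal_sigmaR_le_span_of_admissible (e.symm ∘ ![X 0, X 1]) ![2, 1] τ (a1_map_le σ hC h0 h1 h2 h3 e τ hact) hp hσp 1
    (a1_admissible σ hC h0 h1 h2 h3 e τ hact)
  rwa [map_one, one_mul] at h

include hact h1 in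
/-- `σ_R (x₁T) − x₁T = x₀T = X₁·s` in `R^w`. -/
theorem a1_sigmaR_u'_one_sub :
    (hσJ : ∀ n : ℕ, ((weightedFiltration (e.symm ∘ ![X 0, X 1]) ![2, 1]).ideal n).map (τ : A →+* A) ≤ (weightedFiltration (e.symm ∘ ![X 0, X 1]) ![2, 1]).ideal n) →
    sigmaR τ (e.symm ∘ ![X 0, X 1]) ![2, 1] hσJ hp hσp (cobordantAlgebra.u' (e.symm ∘ ![X 0, X 1]) ![2, 1] 1) - cobordantAlgebra.u' (e.symm ∘ ![X 0, X 1]) ![2, 1] 1 =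
      cobordantAlgebra.u' (e.symm ∘ ![X 0, X 1]) ![2, 1] 0 * cobordantAlgebra.s (e.symm ∘ ![X 0, X 1]) ![2, 1] := by
  intro hσJ
  refine Subtype.ext ?_
  have hu1 : cobordantAlgebra.u' (e.symm ∘ ![X 0, X 1]) ![2, 1] 1 = ⟨LaurentPolynomial.C ((e.symm ∘ ![X 0, X 1]) 1) * LaurentPolynomial.T ((![2, 1] : Fin 2 → ℕ) 1 : ℤ), (cobordantAlgebra.u' (e.symm ∘ ![X 0, X 1]) ![2, 1] 1).2⟩ := rfl
  rw [AddSubgroupClass.coe_sub, MulMemClass.coe_mul, cobordantAlgebra.coe_u', cobordantAlgebra.coe_s, hu1, sigmaR_mk, cobordantAlgebra.coe_u']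
  change LaurentPolynomial.C (τ (e.symm (X 1))) * LaurentPolynomial.T ((1 : ℕ) : ℤ) - LaurentPolynomial.C (e.symm (X 1)) * LaurentPolynomial.T ((1 : ℕ) : ℤ) =
    LaurentPolynomial.C (e.symm (X 0)) * LaurentPolynomial.T ((2 : ℕ) : ℤ) * LaurentPolynomial.T (-1)
  rw [act_symm σ e τ hact, h1, map_add, map_add, mul_assoc, ← LaurentPolynomial.T_add]
  norm_num
  ring

include hact h3 in
/-- `σ_R (x₃) − x₃ = x₁x₂ = s·(X₂·x₂)` in `R^w` (`X₂ = x₁T`, 0-indexed). -/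
theorem a1_sigmaR_algebraMap_three_sub :
    (hσJ : ∀ n : ℕ, ((weightedFiltration (e.symm ∘ ![X 0, X 1]) ![2, 1]).ideal n).map (τ : A →+* A) ≤ (weightedFiltration (e.symm ∘ ![X 0, X 1]) ![2, 1]).ideal n) →
    sigmaR τ (e.symm ∘ ![X 0, X 1]) ![2, 1] hσJ hp hσp (algebraMap A _ (e.symm (X 3))) - algebraMap A _ (e.symm (X 3)) =
      cobordantAlgebra.u' (e.symm ∘ ![X 0, X 1]) ![2, 1] 1 * algebraMap A _ (e.symm (X 2)) * cobordantAlgebra.s (e.symm ∘ ![X 0, X 1]) ![2, 1] := by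
  intro hσJ
  refine Subtype.ext ?_
  rw [AddSubgroupClass.coe_sub, MulMemClass.coe_mul, MulMemClass.coe_mul, sigmaR_algebraMap, cobordantAlgebra.coe_algebraMap, cobordantAlgebra.coe_algebraMap,
    cobordantAlgebra.coe_algebraMap, cobordantAlgebra.coe_u', cobordantAlgebra.coe_s]
  change LaurentPolynomial.C (τ (e.symm (X 3))) - LaurentPolynomial.C (e.symm (X 3)) =
    LaurentPolynomial.C (e.symm (X 1)) * LaurentPolynomial.T ((1 : ℕ) : ℤ) * LaurentPolynomial.C (e.symm (X 2)) * LaurentPolynomial.T (-1)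
  rw [act_symm σ e τ hact, h3, map_add, map_mul, map_add, map_mul]
  have hT : LaurentPolynomial.T ((1 : ℕ) : ℤ) * LaurentPolynomial.T (-1) = (1 : A[T;T⁻¹]) := by
    rw [← LaurentPolynomial.T_add]; norm_num
  calc LaurentPolynomial.C (e.symm (X 3)) + LaurentPolynomial.C (e.symm (X 1)) * LaurentPolynomial.C (e.symm (X 2)) - LaurentPolynomial.C (e.symm (X 3))
      = LaurentPolynomial.C (e.symm (X 1)) * LaurentPolynomial.C (e.symm (X 2)) * (LaurentPolynomial.T ((1 : ℕ) : ℤ) * LaurentPolynomial.T (-1)) := by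
        rw [hT]; ring
    _ = _ := by ring

include hC h0 h1 h2 h3 hact in
/-- ★ **`X₁ = x₀T² ∈ 𝔞₁`**: the cover generator of weight 2 lies in the residual ideal `(aug σ_R : s)` of move 1. [OURS · L1 W4.5c · F13] -/
theorem a1_u'_zero_mem_residual :
    cobordantAlgebra.u' (e.symm ∘ ![X 0, X 1]) ![2, 1] 0 ∈ (augmentationIdeal (sigmaR τ (e.symm ∘ ![X 0, X 1]) ![2, 1] (a1_map_le σ hC h0 h1 h2 h3 e τ hact) hp hσp)).colon
      (Ideal.span {cobordantAlgebra.s (e.symm ∘ ![X 0, X 1]) ![2, 1]}) := by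
  rw [Ideal.mem_colon_span_singleton, ← a1_sigmaR_u'_one_sub σ h1 e τ hact hp hσp (a1_map_le σ hC h0 h1 h2 h3 e τ hact)]
  exact sub_mem_augmentationIdeal _ _

include hC h0 h1 h2 h3 hact in
/-- ★ **`X₂·x₂ = (x₁T)·x₂ ∈ 𝔞₁`** (0-indexed; the memo's `X₂x₃`). [OURS · L1 W4.5c · F13] -/
theorem a1_u'_one_mul_mem_residual :
    cobordantAlgebra.u' (e.symm ∘ ![X 0, X 1]) ![2, 1] 1 * algebraMap A _ (e.symm (X 2)) ∈
      (augmentationIdeal (sigmaR τ (e.symm ∘ ![X 0, X 1]) ![2, 1] (a1_map_le σ hC h0 h1 h2 h3 e τ hact) hp hσp)).colon (Ideal.span {cobordantAlgebra.s (e.symm ∘ ![X 0, X 1]) ![2, 1]}) := by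
  rw [Ideal.mem_colon_span_singleton, ← a1_sigmaR_algebraMap_three_sub σ h3 e τ hact hp hσp (a1_map_le σ hC h0 h1 h2 h3 e τ hact)]
  exact sub_mem_augmentationIdeal _ _

end Residual

end Summit.ResolutionOfSingularities.ResolutionOfSingularities.Theorems.WildQuotientResolution.S1.KillCert.A1

end
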